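import Summits.SmoothPoincare4.SmoothPoincare4.Theorems.ShadowApproximation.Negative.ShadowsOnlyFalseFields
import Literature.Topology.FourManifolds.SurfaceGroupGenusOne

/-!
# `ShadowApproximation` — negative-side support III(a): Dehn twists of `S₃` and the unit twist at level `5`

Support file for the crux `CongruenceShadows.ShadowApproximation` (stmt-SmoothPoincare4-14595),
standing disprover's work file `Cruxes/ShadowApproximation/Disproof.lean` §6 (cycle 2); consumed by
`Negative/LevelSymmetriesFalse.lean` (the units obstruction: level symmetries need not lift).

Contents (all proved, genus `3`, `S = S₃`, `Nᵢ = s4Kernels i`):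
* `liftHom`, `rel_three` — homs out of the one-relator group `S₃` from generator images;
* `twA`, `twB : S ≃* S` — the Dehn twists about `a₀` (`b₀ ↦ b₀a₀`) and `b₀` (`a₀ ↦ a₀b₀`), which fix
  `[a₀,b₀]` on the nose, hence extend by the identity on handles `1, 2`;
* `delta = τ_a³ ∘ τ_b⁻² ∘ τ_a² ∘ τ_b ∘ τ_a⁻¹` — the UNIT TWIST of handle `0`: on `ℤ⟨a₀,b₀⟩` it is
  `[[-12, 5], [-5, 2]] ≡ diag(3, 2) (mod 5)`, the split-torus element `h(3) = w(3)w(1)⁻¹`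
  (`w(t) = u(t) l(-t⁻¹) u(t)`) of `SL₂(𝔽₅)`; explicit words `delta_a0`, `delta_b0`;
* `homZ5`, `M5 = ⋂ ker (S₃ → 𝔽₅) = [S₃,S₃]·S₃⁵` — the mod-5 homology level, characteristic of finite
  index (`M5_characteristic`, `M5_finiteIndex`);
* `homZ5_delta` : `χ_v ∘ δ = χ_{v^c}`, `c(a₀) = 3`, `c(b₀) = 2`, `c = 1` else (and `homZ5_delta_symm`);
* `map_sup_M5_eq` — a diagonal level-5 intertwining for `φ` and `φ⁻¹` gives `φ(⟪G⟫ ⊔ M₅) = ⟪G⟫ ⊔ M₅`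
  for every generator set `G`; hence `delta_level : δ(Nᵢ ⊔ M₅) = Nᵢ ⊔ M₅` for `i = 0, 1, 2` —
  `δ` is a symmetry of all three level-5 shadows of the standard genus-3 trisection of `S⁴`.
-/

noncomputable section

namespace Summit.SmoothPoincare4.SmoothPoincare4.Theorems.ShadowApproximation.Negative

set_option linter.dupNamespace false

open Literature.Topology.FourManifolds
open Summit.SmoothPoincare4.SmoothPoincare4.Theses.CongruenceShadows
open SurfaceGroup

/-! ## Genus-3 toolkit: the relation, homs and automorphisms from generator images -/

/-- Fold a generator of `S₃` into the `a`-notation. [folklore] -/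
theorem of_eq_a (i : Fin 3) : (PresentedGroup.of (i, false) : S) = a i := rfl

/-- Fold a generator of `S₃` into the `b`-notation. [folklore] -/
theorem of_eq_b (i : Fin 3) : (PresentedGroup.of (i, true) : S) = b i := rfl

/-- The defining relation of `S₃`: `[a₀,b₀]([a₁,b₁][a₂,b₂]) = 1`. [folklore] -/
theorem rel_three : a 0 * b 0 * (a 0)⁻¹ * (b 0)⁻¹ * (a 1 * b 1 * (a 1)⁻¹ * (b 1)⁻¹ *
    (a 2 * b 2 * (a 2)⁻¹ * (b 2)⁻¹)) = (1 : S) := by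
  have h : PresentedGroup.mk ({surfaceRelator 3} : Set (FreeGroup (surfaceGen 3)))
      (genA 0 * genB 0 * (genA 0)⁻¹ * (genB 0)⁻¹ * (genA 1 * genB 1 * (genA 1)⁻¹ * (genB 1)⁻¹ *
        (genA 2 * genB 2 * (genA 2)⁻¹ * (genB 2)⁻¹))) = 1 := by
    rw [← surfaceRelator_three]
    exact PresentedGroup.one_of_mem (Set.mem_singleton _)
  simpa [map_mul, map_inv, genA, genB, SurfaceGroup.a, SurfaceGroup.b, PresentedGroup.of] using h

/-- Evaluate the lifted genus-3 relator from generator images. [folklore] -/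
theorem lift_surfaceRelator_three {Q : Type*} [Group Q] (f : surfaceGen 3 → Q) :
    FreeGroup.lift f (surfaceRelator 3) =
      f (0, false) * f (0, true) * (f (0, false))⁻¹ * (f (0, true))⁻¹ *
      (f (1, false) * f (1, true) * (f (1, false))⁻¹ * (f (1, true))⁻¹ *
      (f (2, false) * f (2, true) * (f (2, false))⁻¹ * (f (2, true))⁻¹)) := by
  simp [surfaceRelator_three, genA, genB]

/-- A homomorphism out of `S₃` from generator images killing the relator. [folklore] -/
def liftHom {Q : Type*} [Group Q] (f : surfaceGen 3 → Q)
    (h : FreeGroup.lift f (surfaceRelator 3) = 1) : S →* Q :=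
  PresentedGroup.toGroup (f := f) (by
    intro r hr
    rw [Set.mem_singleton_iff] at hr
    subst hr
    exact h)

/-- `liftHom` on a generator. [folklore] -/
@[simp] theorem liftHom_of {Q : Type*} [Group Q] (f : surfaceGen 3 → Q) (h) (p : surfaceGen 3) :
    liftHom f h (PresentedGroup.of p) = f p :=
  PresentedGroup.toGroup.of _

/-- `liftHom` on `aᵢ`. [folklore] -/
@[simp] theorem liftHom_a {Q : Type*} [Group Q] (f : surfaceGen 3 → Q) (h) (i : Fin 3) :
    liftHom f h (a i) = f (i, false) :=
  PresentedGroup.toGroup.of _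

/-- `liftHom` on `bᵢ`. [folklore] -/
@[simp] theorem liftHom_b {Q : Type*} [Group Q] (f : surfaceGen 3 → Q) (h) (i : Fin 3) :
    liftHom f h (b i) = f (i, true) :=
  PresentedGroup.toGroup.of _

/-! ## The Dehn twists `τ_a`, `τ_b` about `a₀` and `b₀` -/

/-- Generator images of `τ_a`: `b₀ ↦ b₀a₀`, all other generators fixed. [folklore] -/
def twAFun (p : surfaceGen 3) : S :=
  if p = ((0 : Fin 3), true) then b 0 * a 0 else PresentedGroup.of p

/-- Generator images of `τ_a⁻¹`: `b₀ ↦ b₀a₀⁻¹`. [folklore] -/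
def twAInvFun (p : surfaceGen 3) : S :=
  if p = ((0 : Fin 3), true) then b 0 * (a 0)⁻¹ else PresentedGroup.of p

/-- Generator images of `τ_b`: `a₀ ↦ a₀b₀`, all other generators fixed. [folklore] -/
def twBFun (p : surfaceGen 3) : S :=
  if p = ((0 : Fin 3), false) then a 0 * b 0 else PresentedGroup.of p

/-- Generator images of `τ_b⁻¹`: `a₀ ↦ a₀b₀⁻¹`. [folklore] -/
def twBInvFun (p : surfaceGen 3) : S :=
  if p = ((0 : Fin 3), false) then a 0 * (b 0)⁻¹ else PresentedGroup.of p

/-- `τ_a` kills the relator (`[a₀, b₀a₀] = [a₀,b₀]` on the nose). [folklore] -/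
theorem twAFun_rel : FreeGroup.lift twAFun (surfaceRelator 3) = 1 := by
  rw [lift_surfaceRelator_three, ← rel_three]
  simp [twAFun, of_eq_a, of_eq_b, mul_assoc]

/-- `τ_a⁻¹` kills the relator. [folklore] -/
theorem twAInvFun_rel : FreeGroup.lift twAInvFun (surfaceRelator 3) = 1 := by
  rw [lift_surfaceRelator_three, ← rel_three]
  simp [twAInvFun, of_eq_a, of_eq_b, mul_assoc]

/-- `τ_b` kills the relator (`[a₀b₀, b₀] = [a₀,b₀]` on the nose). [folklore] -/
theorem twBFun_rel : FreeGroup.lift twBFun (surfaceRelator 3) = 1 := by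
  rw [lift_surfaceRelator_three, ← rel_three]
  simp [twBFun, of_eq_a, of_eq_b, mul_assoc]

/-- `τ_b⁻¹` kills the relator. [folklore] -/
theorem twBInvFun_rel : FreeGroup.lift twBInvFun (surfaceRelator 3) = 1 := by
  rw [lift_surfaceRelator_three, ← rel_three]
  simp [twBInvFun, of_eq_a, of_eq_b, mul_assoc]

/-- `τ_a` as an endomorphism. [folklore] -/
def twAHom : S →* S := liftHom twAFun twAFun_rel
/-- `τ_a⁻¹` as an endomorphism. [folklore] -/
def twAInvHom : S →* S := liftHom twAInvFun twAInvFun_rel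
/-- `τ_b` as an endomorphism. [folklore] -/
def twBHom : S →* S := liftHom twBFun twBFun_rel
/-- `τ_b⁻¹` as an endomorphism. [folklore] -/
def twBInvHom : S →* S := liftHom twBInvFun twBInvFun_rel

/-- `τ_a⁻¹ ∘ τ_a = id`. [folklore] -/
theorem twAInv_comp : twAInvHom.comp twAHom = MonoidHom.id _ := by
  apply PresentedGroup.ext
  rintro ⟨i, _ | _⟩ <;> fin_cases i <;>
    simp [twAHom, twAInvHom, twAFun, twAInvFun, of_eq_a, of_eq_b]

/-- `τ_a ∘ τ_a⁻¹ = id`. [folklore] -/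
theorem twA_comp_inv : twAHom.comp twAInvHom = MonoidHom.id _ := by
  apply PresentedGroup.ext
  rintro ⟨i, _ | _⟩ <;> fin_cases i <;>
    simp [twAHom, twAInvHom, twAFun, twAInvFun, of_eq_a, of_eq_b]

/-- `τ_b⁻¹ ∘ τ_b = id`. [folklore] -/
theorem twBInv_comp : twBInvHom.comp twBHom = MonoidHom.id _ := by
  apply PresentedGroup.ext
  rintro ⟨i, _ | _⟩ <;> fin_cases i <;>
    simp [twBHom, twBInvHom, twBFun, twBInvFun, of_eq_a, of_eq_b]

/-- `τ_b ∘ τ_b⁻¹ = id`. [folklore] -/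
theorem twB_comp_inv : twBHom.comp twBInvHom = MonoidHom.id _ := by
  apply PresentedGroup.ext
  rintro ⟨i, _ | _⟩ <;> fin_cases i <;>
    simp [twBHom, twBInvHom, twBFun, twBInvFun, of_eq_a, of_eq_b]

/-- **The Dehn twist about `a₀`** (`b₀ ↦ b₀a₀`), an automorphism of `S₃`. [folklore] -/
def twA : S ≃* S := MonoidHom.toMulEquiv twAHom twAInvHom twAInv_comp twA_comp_inv

/-- **The Dehn twist about `b₀`** (`a₀ ↦ a₀b₀`), an automorphism of `S₃`. [folklore] -/
def twB : S ≃* S := MonoidHom.toMulEquiv twBHom twBInvHom twBInv_comp twB_comp_inv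

/-- `τ_a a₀ = a₀`. [folklore] -/
@[simp] theorem twA_a0 : twA (a 0) = a 0 := by simp [twA, twAHom, twAFun, of_eq_a]
/-- `τ_a b₀ = b₀a₀`. [folklore] -/
@[simp] theorem twA_b0 : twA (b 0) = b 0 * a 0 := by simp [twA, twAHom, twAFun]
/-- `τ_a⁻¹ a₀ = a₀`. [folklore] -/
@[simp] theorem twA_symm_a0 : twA.symm (a 0) = a 0 := by simp [twA, twAInvHom, twAInvFun, of_eq_a]
/-- `τ_a⁻¹ b₀ = b₀a₀⁻¹`. [folklore] -/
@[simp] theorem twA_symm_b0 : twA.symm (b 0) = b 0 * (a 0)⁻¹ := by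
  simp [twA, twAInvHom, twAInvFun]
/-- `τ_b a₀ = a₀b₀`. [folklore] -/
@[simp] theorem twB_a0 : twB (a 0) = a 0 * b 0 := by simp [twB, twBHom, twBFun]
/-- `τ_b b₀ = b₀`. [folklore] -/
@[simp] theorem twB_b0 : twB (b 0) = b 0 := by simp [twB, twBHom, twBFun, of_eq_b]
/-- `τ_b⁻¹ a₀ = a₀b₀⁻¹`. [folklore] -/
@[simp] theorem twB_symm_a0 : twB.symm (a 0) = a 0 * (b 0)⁻¹ := by
  simp [twB, twBInvHom, twBInvFun]
/-- `τ_b⁻¹ b₀ = b₀`. [folklore] -/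
@[simp] theorem twB_symm_b0 : twB.symm (b 0) = b 0 := by simp [twB, twBInvHom, twBInvFun, of_eq_b]

/-- `τ_a` fixes the generators of handles `1, 2`. [folklore] -/
theorem twA_of {p : surfaceGen 3} (hp : p.1 ≠ 0) : twA (PresentedGroup.of p) = PresentedGroup.of p := by
  have : p ≠ ((0 : Fin 3), true) := fun h => hp (by rw [h])
  simp [twA, twAHom, twAFun, this]

/-- `τ_a⁻¹` fixes the generators of handles `1, 2`. [folklore] -/
theorem twA_symm_of {p : surfaceGen 3} (hp : p.1 ≠ 0) :
    twA.symm (PresentedGroup.of p) = PresentedGroup.of p := by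
  have : p ≠ ((0 : Fin 3), true) := fun h => hp (by rw [h])
  simp [twA, twAInvHom, twAInvFun, this]

/-- `τ_b` fixes the generators of handles `1, 2`. [folklore] -/
theorem twB_of {p : surfaceGen 3} (hp : p.1 ≠ 0) : twB (PresentedGroup.of p) = PresentedGroup.of p := by
  have : p ≠ ((0 : Fin 3), false) := fun h => hp (by rw [h])
  simp [twB, twBHom, twBFun, this]

/-- `τ_b⁻¹` fixes the generators of handles `1, 2`. [folklore] -/
theorem twB_symm_of {p : surfaceGen 3} (hp : p.1 ≠ 0) :
    twB.symm (PresentedGroup.of p) = PresentedGroup.of p := by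
  have : p ≠ ((0 : Fin 3), false) := fun h => hp (by rw [h])
  simp [twB, twBInvHom, twBInvFun, this]

/-! ## The unit twist `δ` -/

/-- **The unit twist** `δ = τ_a³ ∘ τ_b⁻² ∘ τ_a² ∘ τ_b ∘ τ_a⁻¹ ∈ Aut S₃` (rightmost factor first): the
mapping class of handle `0` acting on `ℤ⟨a₀, b₀⟩` by `[[-12, 5], [-5, 2]] ≡ diag(3, 2) (mod 5)`,
i.e. the torus element `h(3) = w(3)w(1)⁻¹`, `w(t) = u(t) l(-t⁻¹) u(t)`, of `SL₂(𝔽₅)`. [folklore] -/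
def delta : S ≃* S :=
  (((((((twA.symm.trans twB).trans twA).trans twA).trans twB.symm).trans twB.symm).trans
    twA).trans twA).trans twA

/-- `δ` unfolded. [folklore] -/
theorem delta_apply (x : S) :
    delta x = twA (twA (twA (twB.symm (twB.symm (twA (twA (twB (twA.symm x)))))))) := rfl

/-- `δ(b₀) = b₀ a₀³ b₀ a₀²`. [folklore] -/
theorem delta_b0 : delta (b 0) = b 0 * a 0 ^ 3 * b 0 * a 0 ^ 2 := by
  simp only [delta_apply, twA_symm_b0, map_mul, map_inv, twB_b0, twB_a0, twA_a0, twA_b0,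
    twB_symm_a0, twB_symm_b0]
  group

/-- `δ(a₀) = a₀⁻²b₀⁻¹a₀⁻²b₀⁻¹a₀⁻³b₀⁻¹a₀⁻²b₀⁻¹a₀⁻³b₀⁻¹` (exponent sums `(-12, -5)`). [folklore] -/
theorem delta_a0 : delta (a 0) = (a 0)⁻¹ * (a 0)⁻¹ * (b 0)⁻¹ * (a 0)⁻¹ * (a 0)⁻¹ * (b 0)⁻¹ *
    (a 0)⁻¹ * (a 0)⁻¹ * (a 0)⁻¹ * (b 0)⁻¹ * (a 0)⁻¹ * (a 0)⁻¹ * (b 0)⁻¹ *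
    (a 0)⁻¹ * (a 0)⁻¹ * (a 0)⁻¹ * (b 0)⁻¹ := by
  simp only [delta_apply, twA_symm_a0, map_mul, map_inv, twB_a0, twA_a0, twA_b0,
    twB_symm_a0, twB_symm_b0]
  group

/-- `δ` fixes the generators of handles `1, 2`. [folklore] -/
theorem delta_of {p : surfaceGen 3} (hp : p.1 ≠ 0) : delta (PresentedGroup.of p) = PresentedGroup.of p := by
  simp only [delta_apply, twA_symm_of hp, twB_of hp, twA_of hp, twB_symm_of hp]

/-! ## The mod-5 homology level `M₅` -/

/-- Homs `S₃ → 𝔽₅` (written multiplicatively) from generator values. [folklore] -/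
def homZ5 (v : surfaceGen 3 → Multiplicative (ZMod 5)) : S →* Multiplicative (ZMod 5) :=
  SurfaceGroup.toCommGroup v

/-- `homZ5` on a generator. [folklore] -/
@[simp] theorem homZ5_of (v : surfaceGen 3 → Multiplicative (ZMod 5)) (p : surfaceGen 3) :
    homZ5 v (PresentedGroup.of p) = v p := SurfaceGroup.toCommGroup_of v p
/-- `homZ5` on `aᵢ`. [folklore] -/
@[simp] theorem homZ5_a (v : surfaceGen 3 → Multiplicative (ZMod 5)) (i : Fin 3) :
    homZ5 v (a i) = v (i, false) := SurfaceGroup.toCommGroup_a v i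
/-- `homZ5` on `bᵢ`. [folklore] -/
@[simp] theorem homZ5_b (v : surfaceGen 3 → Multiplicative (ZMod 5)) (i : Fin 3) :
    homZ5 v (b i) = v (i, true) := SurfaceGroup.toCommGroup_b v i

/-- Every hom `S₃ → 𝔽₅` is a `homZ5`. [folklore] -/
theorem eq_homZ5 (f : S →* Multiplicative (ZMod 5)) : f = homZ5 (fun p => f (PresentedGroup.of p)) :=
  PresentedGroup.ext fun p => by simp

/-- **`M₅ = [S₃,S₃]·S₃⁵ = ⋂ ker (S₃ → 𝔽₅)`**, the mod-5 homology level. [folklore] -/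
def M5 : Subgroup S := ⨅ v, (homZ5 v).ker

/-- Membership in `M₅`. [folklore] -/
theorem mem_M5 {s : S} : s ∈ M5 ↔ ∀ v, homZ5 v s = 1 := by
  simp [M5, Subgroup.mem_iInf, MonoidHom.mem_ker]

/-- `M₅` has finite index (`5⁶`). [folklore] -/
instance M5_finiteIndex : M5.FiniteIndex := Subgroup.finiteIndex_iInf fun _ => inferInstance

/-- `M₅` is characteristic (automorphisms permute the homs to `𝔽₅`). [folklore] -/
instance M5_characteristic : M5.Characteristic := by
  refine Subgroup.characteristic_iff_le_comap.2 fun φ s hs => ?_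
  rw [Subgroup.mem_comap, mem_M5]
  intro v
  have := (mem_M5.1 hs) (fun p => homZ5 v (φ (PresentedGroup.of p)))
  rw [← MonoidHom.comp_apply, eq_homZ5 ((homZ5 v).comp φ.toMonoidHom)]
  simpa using this

/-- Every hom to `𝔽₅` kills `M₅`. [folklore] -/
theorem M5_le_ker (v : surfaceGen 3 → Multiplicative (ZMod 5)) : M5 ≤ (homZ5 v).ker :=
  iInf_le (fun v => (homZ5 v).ker) v

/-! ## `δ` at level `5`: `a₀ ↦ 3a₀`, `b₀ ↦ 2b₀` -/

/-- Exponents of `δ` on generators mod `5`. [folklore] -/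
def cδ (p : surfaceGen 3) : ℕ := if p = ((0 : Fin 3), false) then 3 else if p = ((0 : Fin 3), true) then 2 else 1

/-- Exponents of `δ⁻¹` on generators mod `5` (`3·2 ≡ 1`). [folklore] -/
def cδ' (p : surfaceGen 3) : ℕ := if p = ((0 : Fin 3), false) then 2 else if p = ((0 : Fin 3), true) then 3 else 1

/-- **`δ` mod `5`**: `χ_v ∘ δ = χ_{v^c}` with `c(a₀) = 3`, `c(b₀) = 2`, `c = 1` otherwise. [folklore] -/
theorem homZ5_delta (v : surfaceGen 3 → Multiplicative (ZMod 5)) :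
    (homZ5 v).comp delta.toMonoidHom = homZ5 (fun p => v p ^ cδ p) := by
  have ka : ∀ x y : Multiplicative (ZMod 5), x⁻¹ * x⁻¹ * y⁻¹ * x⁻¹ * x⁻¹ * y⁻¹ * x⁻¹ * x⁻¹ * x⁻¹ *
      y⁻¹ * x⁻¹ * x⁻¹ * y⁻¹ * x⁻¹ * x⁻¹ * x⁻¹ * y⁻¹ = x ^ 3 := by decide
  have kb : ∀ x y : Multiplicative (ZMod 5), y * x ^ 3 * y * x ^ 2 = y ^ 2 := by decide
  apply PresentedGroup.ext
  rintro ⟨i, _ | _⟩ <;> fin_cases i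
  · -- a₀
    simp only [MonoidHom.comp_apply, MulEquiv.coe_toMonoidHom, homZ5_of]
    rw [show ((⟨0, by omega⟩ : Fin 3), false) = ((0 : Fin 3), false) from rfl, of_eq_a, delta_a0]
    simp only [map_mul, map_inv, homZ5_a, homZ5_b, ka, cδ, if_true]
  · simp [delta_of, cδ]
  · simp [delta_of, cδ]
  · -- b₀
    simp only [MonoidHom.comp_apply, MulEquiv.coe_toMonoidHom, homZ5_of]
    rw [show ((⟨0, by omega⟩ : Fin 3), true) = ((0 : Fin 3), true) from rfl, of_eq_b, delta_b0]
    simp only [map_mul, map_pow, homZ5_a, homZ5_b, kb, cδ]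
    simp
  · simp [delta_of, cδ]
  · simp [delta_of, cδ]

/-- `δ⁻¹` mod `5`: `χ_v ∘ δ⁻¹ = χ_{v^{c'}}`, `c'(a₀) = 2`, `c'(b₀) = 3`. [folklore] -/
theorem homZ5_delta_symm (v : surfaceGen 3 → Multiplicative (ZMod 5)) :
    (homZ5 v).comp delta.symm.toMonoidHom = homZ5 (fun p => v p ^ cδ' p) := by
  have h := homZ5_delta (fun p => v p ^ cδ' p)
  have hv : (fun p => (v p ^ cδ' p) ^ cδ p) = v := by
    funext p
    have h6 : ∀ x : Multiplicative (ZMod 5), x ^ 6 = x := by decide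
    rcases p with ⟨i, _ | _⟩ <;> fin_cases i <;> simp [cδ, cδ', ← pow_mul, h6]
  rw [hv] at h
  have hid : delta.toMonoidHom.comp delta.symm.toMonoidHom = MonoidHom.id _ := by ext x; simp
  rw [← h, MonoidHom.comp_assoc, hid, MonoidHom.comp_id]

/-! ## Level invariance from a level-5 intertwining -/

/-- A diagonal level-5 intertwining `χ_v ∘ φ = χ_{v^c}` makes `φ` map `⟪G⟫ ⊔ M₅` into itself, for
any set `G` of generators. [folklore] -/
theorem map_sup_M5_le (φ : S ≃* S) (c : surfaceGen 3 → ℕ)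
    (hφ : ∀ v, (homZ5 v).comp φ.toMonoidHom = homZ5 (fun p => v p ^ c p))
    (G : Finset (surfaceGen 3)) :
    (Subgroup.normalClosure (PresentedGroup.of '' (G : Set (surfaceGen 3))) ⊔ M5).map φ.toMonoidHom ≤
      Subgroup.normalClosure (PresentedGroup.of '' (G : Set (surfaceGen 3))) ⊔ M5 := by
  rw [Subgroup.map_sup, (Subgroup.characteristic_iff_map_eq.1 M5_characteristic) φ]
  refine sup_le ?_ le_sup_right
  rw [Subgroup.map_normalClosure _ _ φ.surjective]
  refine Subgroup.normalClosure_le_normal ?_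
  rintro _ ⟨_, ⟨p, hp, rfl⟩, rfl⟩
  have hm : φ (PresentedGroup.of p) * (PresentedGroup.of p ^ c p)⁻¹ ∈ M5 := by
    rw [mem_M5]
    intro v
    have := DFunLike.congr_fun (hφ v) (PresentedGroup.of p)
    simp only [MonoidHom.comp_apply, MulEquiv.coe_toMonoidHom, homZ5_of] at this
    rw [map_mul, map_inv, map_pow, this, homZ5_of, mul_inv_cancel]
  have hG : (PresentedGroup.of p : S) ^ c p ∈
      Subgroup.normalClosure (PresentedGroup.of '' (G : Set (surfaceGen 3))) :=
    Subgroup.pow_mem _ (Subgroup.subset_normalClosure (Set.mem_image_of_mem _ hp)) _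
  have e : φ (PresentedGroup.of p) =
      φ (PresentedGroup.of p) * (PresentedGroup.of p ^ c p)⁻¹ * PresentedGroup.of p ^ c p := by group
  rw [SetLike.mem_coe, MulEquiv.coe_toMonoidHom, e]
  exact Subgroup.mul_mem _ (Subgroup.mem_sup_right hm) (Subgroup.mem_sup_left hG)

/-- With intertwinings for `φ` and `φ⁻¹`, `φ(⟪G⟫ ⊔ M₅) = ⟪G⟫ ⊔ M₅`. [folklore] -/
theorem map_sup_M5_eq (φ : S ≃* S) (c c' : surfaceGen 3 → ℕ)
    (hφ : ∀ v, (homZ5 v).comp φ.toMonoidHom = homZ5 (fun p => v p ^ c p))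
    (hφ' : ∀ v, (homZ5 v).comp φ.symm.toMonoidHom = homZ5 (fun p => v p ^ c' p))
    (G : Finset (surfaceGen 3)) :
    (Subgroup.normalClosure (PresentedGroup.of '' (G : Set (surfaceGen 3))) ⊔ M5).map φ.toMonoidHom =
      Subgroup.normalClosure (PresentedGroup.of '' (G : Set (surfaceGen 3))) ⊔ M5 := by
  refine le_antisymm (map_sup_M5_le φ c hφ G) ?_
  set H := Subgroup.normalClosure (PresentedGroup.of '' (G : Set (surfaceGen 3))) ⊔ M5
  have h := map_sup_M5_le φ.symm c' hφ' G
  have hid : φ.toMonoidHom.comp φ.symm.toMonoidHom = MonoidHom.id _ := by ext x; simp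
  calc H = (H.map φ.symm.toMonoidHom).map φ.toMonoidHom := by
        rw [Subgroup.map_map, hid, Subgroup.map_id]
    _ ≤ H.map φ.toMonoidHom := Subgroup.map_mono h

/-- **`δ` is a symmetry of all three level-5 shadows**: `δ(Nᵢ ⊔ M₅) = Nᵢ ⊔ M₅`. [folklore] -/
theorem delta_level (i : Fin 3) : (s4Kernels i ⊔ M5).map delta.toMonoidHom = s4Kernels i ⊔ M5 := by
  rw [s4Kernels_eq i]
  exact map_sup_M5_eq delta cδ cδ' homZ5_delta homZ5_delta_symm (s4Gens i)


end Summit.SmoothPoincare4.SmoothPoincare4.Theorems.ShadowApproximation.Negative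

end
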